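import Mathlib.RingTheory.MvPolynomial.Ideal
import Mathlib.LinearAlgebra.Matrix.SchurComplement
import Literature.Computability.AlgebraicComplexity.AlperBogartVelascoSubspace
import Literature.Computability.AlgebraicComplexity.DeterminantalComplexityProofs
import HarnessLib

/-!
# Alper–Bogart–Velasco 2017: `dc(f) ≥ codim Sing(f) + 1` (Thm. 1.2 in general) and §1–§2

Topic `Literature/Computability/AlgebraicComplexity` (cell val-lit, row ABV17-A). Typed literature:
J. Alper, T. Bogart, M. Velasco, *A lower bound for the determinantal complexity of a
hypersurface*, Found. Comput. Math. 17 (2017) 829–836, doi:10.1007/s10208-015-9300-x =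
arXiv:1505.02205 (HELD as `paper:arxiv-1505.02205`, 3000-char chunks `p0001`–`p0007`; locators
below are `pNNNN.txt:Lnn` of that materialisation, plus the printed numbering). Honest framing:
this is typed and (where cheap) kernel-checked literature on lower bounds for the determinantal
complexity `dc`; VP ≠ VNP is NOT proved and nothing here is progress on it.

## The dictionary `codim Sing(f)` ↔ height

ABV write `Sing(f)` for the singular locus of the affine hypersurface `V(f) ⊆ kⁿ` and use only its
codimension (p0003.txt:L8). As in the tree's treatment of the permanent
(`VonZurGathen.singPermIdeal`, `VonZurGathenRegularity.lean`, module docstring: irreducible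
components of `V(J)` ↔ minimal primes of `J`, `dim V(P) = n - height P`), we phrase it through the
**singular ideal** `singIdeal f = (f, ∂f/∂x₁, …, ∂f/∂xₙ)` (whose zero set is `Sing(f)`):

  `codim Sing(f) := (singIdeal f).height : ℕ∞`,

Mathlib's `Ideal.height` of an ideal being the infimum of the heights of its minimal primes, i.e.
the codimension of the largest component of `V(singIdeal f)` over an algebraic closure — exactly
ABV's `codim`. (For `f` homogeneous of degree `≥ 2`, `0 ∈ Sing(f) ≠ ∅`; `singIdeal f = ⊤` has
height `⊤`.) `singIdeal (perPoly (Fin m) K)` is DEFINITIONALLY `VonZurGathen.singPermIdeal K m`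
(`singIdeal_perPoly`), so the permanent statements below are literal instances.

## Contents (source item → declaration → status)

* Def. 1.1 (p0003.txt:L5, `dc`) → the tree's `determinantalComplexity` / `IsAffineDetRepr`
  (`DeterminantalComplexity.lean`) — CITED, not restated; likewise the state of the art (1),
  p0003.txt:L24–L29, `n²/2 ≤ dc(per_n) ≤ 2ⁿ - 1` = the tree's Mignon–Ressayre and Grenet theorems
  (`sq_le_two_mul_determinantalComplexity_perPoly_charZero_holds`,
  `determinantalComplexity_perPoly_le_holds`) — CITED.
* **Prop. 2.1 + Rem. 2.2** (p0005.txt:L5, L21) → `alperBogartVelasco2017_prop_2_1` (any polynomial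
  matrix, any point: `rank L(v) ≥ m - 1`) and `alperBogartVelasco2017_prop_2_1_rank_zero`
  (`rank L(0) = m - 1`) — PROVED (Eagon's height bound for submaximal minors,
  `VonZurGathen.exists_minimalPrimes_adjIdeal_height_le_four`, replaces "the standard bound for
  the codimension of an inverse image").
* **Thm. 1.2** (p0003.txt:L10) → `alperBogartVelasco2017_thm_1_2` — PROVED, following the printed
  proof (p0005.txt:L23–L40) step by step: Prop. 2.1, normal form `L = J + Z(x)`
  (`exists_mul_mul_eq_lamMatrix`), `Z₁₁ = 0` and `Σ_j Z_{1j} Z_{j1} = 0`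
  (`AlperBogartVelascoLowOrder.lean`), `f ∈ I`, `∂f/∂xᵢ ∈ I` for the ideal `I` of the first row and
  column of `Z`, `codim V(I) = dim im(G) ≤ m - 1` (isotropy, `AlperBogartVelascoIsotropy.lean`),
  and Krull's height theorem (`Ideal.height_le_card_of_mem_minimalPrimes_span_finset`) for
  `height (singIdeal f) ≤ height I ≤ m - 1`. The engine for one representation is
  `AlperBogartVelasco.height_singIdeal_add_one_le_of_isAffineDetRepr`.
* **Cor. 1.3** (p0003.txt:L33) → `alperBogartVelasco2017_cor_1_3` — PROVED (Thm. 1.2 + von zur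
  Gathen's `codim Sing(per_n) ≥ 5`, `AlperBogartVelasco.five_le_height_of_singPermIdeal_le`).
* Cor. 1.4 (p0003.txt:L40) → `alperBogartVelasco2017_cor_1_4(_holds)` (`AlperBogartVelasco.lean`,
  `AlperBogartVelascoProofs.lean`) — CITED, already PROVED in the tree.
* **Rem. 1.5** (p0003.txt:L45: `codim Sing(per_n) ≤ 2n`, the ceiling of this method:
  "Corollary 1.3 would only give the linear bound `dc(per_n) ≥ 2n + 1`") →
  `alperBogartVelasco2017_rem_1_5` — PROVED (the matrices with two zero columns).
* **Cor. 1.6** (p0003.txt:L53) → `alperBogartVelasco2017_cor_1_6` — PROVED from Thm. 1.2.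
* **Thm. 1.7** (p0003.txt:L61, Bertini) → `alperBogartVelasco2017_thm_1_7_le` (the inequality
  `codim Sing(det ∘ L) ≤ min(4, n)`, PROVED over any field, again by Eagon) and the NAMED FACT
  `alperBogartVelasco2017_thm_1_7_general` (equality for a general linear map `L`, `k`
  algebraically closed of characteristic `0` — Bertini's theorem, not in Mathlib); the bullet
  "if `n > 4` then `V(f)` is singular for every `L`" (p0003.txt:L68) is the PROVED
  `alperBogartVelasco2017_thm_1_7_singular`.
* **Thm. 1.8** (p0004.txt:L7: `dc(xy² + yt² + z³) = 5` in characteristic `0`) → NAMED FACT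
  `alperBogartVelasco2017_thm_1_8` (the lower bound `dc > 4` is the case analysis of
  p0006.txt:L1–L47 on top of Brundu–Logar's `dc > 3`; not vendored) and the PROVED upper bound
  `determinantalComplexity_abvCubic_le_five` (the printed `5 × 5` matrix, p0006.txt:L49–L55).
* Rem. 1.9 (p0004.txt:L9: `dc` is not upper semicontinuous; the loci `dc = m` are constructible)
  is commentary needing the Zariski topology on `Sym^d(kⁿ)^∨`; not typed (no downstream user).

D-0026: the two named facts are the only unproved statements; everything else is a theorem.

## References

* [AlperBogartVelasco2017] J. Alper, T. Bogart, M. Velasco, Found. Comput. Math. 17 (2017)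
  829–836, doi:10.1007/s10208-015-9300-x, arXiv:1505.02205 — Def. 1.1, Thm. 1.2, Cor. 1.3–1.6,
  Rem. 1.5, Thm. 1.7, Thm. 1.8, Rem. 1.9, Prop. 2.1, Rem. 2.2 and the proofs of §2.
* [Vonzurgathen1987] J. von zur Gathen, *Permanent and determinant*, Linear Algebra Appl. 96
  (1987) 87–100 — `codim Sing(per_n) ≥ 5` (Lemma 2.3), used by ABV for Cor. 1.3.
* [BrunduLogar1998] M. Brundu, A. Logar, *Parametrization of the orbits of cubic surfaces*,
  Transform. Groups 3 (1998) 209–239 — `dc(xy² + yt² + z³) > 3`, the input of Thm. 1.8.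
* [Harris1992] J. Harris, *Algebraic Geometry, a first course*, GTM 133 — Bertini's theorem and
  linear spaces on quadrics, as cited by ABV.
-/

noncomputable section

open Matrix MvPolynomial Finset Module

namespace Literature.Computability.AlgebraicComplexity

/-! ### The singular ideal `(f, ∂f/∂xᵢ)` -/

section SingIdeal

variable {K : Type*} [CommRing K] {σ : Type*}

/-- The **singular ideal** of a polynomial `f ∈ K[x_σ]`: the ideal `(f, ∂f/∂xᵢ : i ∈ σ)` generated
by `f` and its first partial derivatives. Its zero set is the singular locus `Sing(f)` of the
affine hypersurface `V(f)` (ABV p0003.txt:L8: "We denote by `Sing(f)` the singular locus of the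
hypersurface `V(f) ⊆ kⁿ`"; vzG87 §2: `sing Y = {a ∈ Y : ∂f/∂yᵢ(a) = 0 ∀ i}`), and ABV's
`codim Sing(f)` is rendered as `(singIdeal f).height` (module docstring). For the generic permanent
this is `VonZurGathen.singPermIdeal` (`singIdeal_perPoly`). [cite: AlperBogartVelasco2017, §1 (Def. before Thm. 1.2)] -/
def singIdeal (f : MvPolynomial σ K) : Ideal (MvPolynomial σ K) :=
  Ideal.span (insert f (Set.range fun i : σ => pderiv i f))

/-- `f ∈ singIdeal f` (`V(singIdeal f) ⊆ V(f)`: the singular locus lies on the hypersurface,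
ABV p0003.txt:L8). [cite: AlperBogartVelasco2017, §1 (definition of Sing(f))] -/
theorem self_mem_singIdeal (f : MvPolynomial σ K) : f ∈ singIdeal f :=
  Ideal.subset_span (Set.mem_insert _ _)

/-- `∂f/∂xᵢ ∈ singIdeal f` (ABV p0003.txt:L8; vzG87 §2). [cite: AlperBogartVelasco2017, §1 (definition of Sing(f))] -/
theorem pderiv_mem_singIdeal (f : MvPolynomial σ K) (i : σ) : pderiv i f ∈ singIdeal f :=
  Ideal.subset_span (Set.mem_insert_of_mem _ ⟨i, rfl⟩)

/-- `singIdeal f ≤ I` iff `I` contains `f` and all its partials — the form in which ABV use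
"`V(I) ⊆ Sing(f)`" (p0005.txt:L27: "`f ∈ I²` and all partial derivatives `∂f/∂xᵢ` are in `I`.
Thus, `V(I) ⊆ Sing(f)`"). [cite: AlperBogartVelasco2017, proof of Thm. 1.2] -/
theorem singIdeal_le_iff {f : MvPolynomial σ K} {I : Ideal (MvPolynomial σ K)} :
    singIdeal f ≤ I ↔ f ∈ I ∧ ∀ i, pderiv i f ∈ I := by
  rw [singIdeal, Ideal.span_le, Set.insert_subset_iff, Set.range_subset_iff]
  rfl

/-- The singular ideal of the generic permanent `per_m` is, definitionally, the tree's
`VonZurGathen.singPermIdeal K m` (vzG87 §2: `sing P_m`). [cite: Vonzurgathen1987, §2] -/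
theorem singIdeal_perPoly (K : Type*) [CommRing K] (m : ℕ) :
    singIdeal (perPoly (Fin m) K) = VonZurGathen.singPermIdeal K m := rfl

/-- The unit ideal has `codim Sing = ⊤` and the zero polynomial has `codim Sing = 0`; in between,
`singIdeal f` is a proper ideal as soon as `f` and its partials have no constant term, e.g. for `f`
homogeneous of degree `≥ 2`: then `singIdeal f` lies in the ideal of all the variables (the origin
is a singular point of the cone, ABV p0003.txt:L46: "any matrix where the first two columns are
zero is a singular point", and p0005.txt:L18: "`det(L(0)) = f(0) = 0`").
[cite: AlperBogartVelasco2017, Rem. 1.5 and Prop. 2.1 (the origin lies on Sing(f))] -/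
theorem singIdeal_le_idealOfVars {f : MvPolynomial σ K} (h0 : constantCoeff f = 0)
    (h1 : ∀ i, constantCoeff (pderiv i f) = 0) : singIdeal f ≤ idealOfVars σ K := by
  have key : ∀ g : MvPolynomial σ K, constantCoeff g = 0 → g ∈ idealOfVars σ K := by
    intro g hg
    rw [← pow_one (idealOfVars σ K), mem_pow_idealOfVars_iff']
    intro x hx
    have hx0 : x = 0 := by
      have : Finsupp.degree x = 0 := by omega
      exact (Finsupp.degree_eq_zero_iff x).1 this
    subst hx0
    simpa [constantCoeff_eq] using hg
  exact singIdeal_le_iff.2 ⟨key f h0, fun i => key _ (h1 i)⟩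

end SingIdeal

namespace AlperBogartVelasco

open VonZurGathen LRPencil

/-! ### Tools: determinants with a row in an ideal; Krull's height theorem packaged -/

section Tools

/-- A determinant with a row in an ideal lies in that ideal (row expansion). [folklore] -/
private theorem det_mem_of_row_mem {R : Type*} [CommRing R] {ι : Type*} [Fintype ι] [DecidableEq ι]
    (I : Ideal R) (M : Matrix ι ι R) (i : ι) (h : ∀ j, M i j ∈ I) : M.det ∈ I := by
  rw [Matrix.det_eq_sum_mul_adjugate_row M i]
  exact Ideal.sum_mem _ fun j _ => Ideal.mul_mem_right _ _ (h j)

/-- A determinant with a column in an ideal lies in that ideal (column expansion). [folklore] -/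
private theorem det_mem_of_col_mem {R : Type*} [CommRing R] {ι : Type*} [Fintype ι] [DecidableEq ι]
    (I : Ideal R) (M : Matrix ι ι R) (j : ι) (h : ∀ i, M i j ∈ I) : M.det ∈ I := by
  rw [Matrix.det_eq_sum_mul_adjugate_col M j]
  exact Ideal.sum_mem _ fun i _ => Ideal.mul_mem_right _ _ (h i)

/-- **Krull's height theorem, packaged**: an ideal contained in a proper ideal generated by the
finite set `T` has height `≤ |T|` (a minimal prime of `(T)` has height `≤ |T|`,
`Ideal.height_le_card_of_mem_minimalPrimes_span_finset`, and heights are monotone). This is the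
form in which ABV's "`codim V(I) ≤ …`" steps are used. [folklore] -/
private theorem height_le_card_of_le_span {R : Type*} [CommRing R] [IsNoetherianRing R] {I : Ideal R}
    {T : Finset R} (hle : I ≤ Ideal.span (T : Set R)) (hT : Ideal.span (T : Set R) ≠ ⊤) :
    I.height ≤ T.card := by
  obtain ⟨p, hp⟩ := Ideal.nonempty_minimalPrimes hT
  exact (Ideal.height_mono (hle.trans hp.1.2)).trans
    (Ideal.height_le_card_of_mem_minimalPrimes_span_finset hp)

/-- An ideal all of whose generators have zero constant term is proper. [folklore] -/
private theorem span_ne_top_of_constantCoeff {K : Type*} [CommRing K] [Nontrivial K] {σ : Type*}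
    {S : Set (MvPolynomial σ K)} (h : ∀ g ∈ S, constantCoeff g = 0) :
    Ideal.span S ≠ ⊤ := by
  have hle : Ideal.span S ≤ RingHom.ker (constantCoeff : MvPolynomial σ K →+* K) := by
    rw [Ideal.span_le]
    intro g hg
    rw [SetLike.mem_coe, RingHom.mem_ker]
    exact h g hg
  exact fun htop => RingHom.ker_ne_top _ (top_le_iff.1 (htop ▸ hle))

/-- `codim Sing(f) ≤ n` for `f ∈ K[x₁, …, xₙ]` whose singular ideal is inside the ideal of the
variables (e.g. `f` homogeneous of degree `≥ 2`): Krull for the `n` variables. This is the bound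
`codim(Sing(f)) ≤ n` inside ABV Thm. 1.7's `≤ min(4, n)` (p0003.txt:L62) and the reason the
hypothesis of Cor. 1.6 reads `codim Sing(f) = n`. [cite: AlperBogartVelasco2017, Thm. 1.7 (the bound ≤ n)] -/
theorem height_singIdeal_le_card {K : Type*} [Field K] {σ : Type*} [Fintype σ]
    {f : MvPolynomial σ K} (h0 : constantCoeff f = 0) (h1 : ∀ i, constantCoeff (pderiv i f) = 0) :
    (singIdeal f).height ≤ Fintype.card σ := by
  classical
  have hvars : idealOfVars σ K =
      Ideal.span ((Finset.univ.image (X : σ → MvPolynomial σ K) : Finset _) : Set _) := by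
    rw [idealOfVars, Finset.coe_image, Finset.coe_univ, Set.image_univ]
  have hle := singIdeal_le_idealOfVars h0 h1
  rw [hvars] at hle
  refine (height_le_card_of_le_span hle (span_ne_top_of_constantCoeff fun g hg => ?_)).trans ?_
  · obtain ⟨i, -, rfl⟩ := Finset.mem_image.1 (Finset.mem_coe.1 hg)
    exact constantCoeff_X K i
  · exact_mod_cast Finset.card_image_le.trans (by rw [Finset.card_univ])

/-- The chain rule `∂(det B)/∂xᵢ ∈ I_{m-1}(B)` and `det B ∈ I_{m-1}(B)` (ABV p0005.txt:L8–L12,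
"it follows that `L⁻¹(Sing(det_m)) ⊆ Sing(f)`"), as the inclusion
`singIdeal (det B) ≤ adjIdeal B` (`VonZurGathen.derivation_det_mem_adjIdeal`).
[cite: AlperBogartVelasco2017, proof of Prop. 2.1] -/
theorem singIdeal_det_le_adjIdeal {K : Type*} [CommRing K] {σ : Type*} {n : ℕ} (hn : 0 < n)
    (B : Matrix (Fin n) (Fin n) (MvPolynomial σ K)) : singIdeal B.det ≤ adjIdeal B := by
  haveI : Nonempty (Fin n) := ⟨⟨0, hn⟩⟩
  exact singIdeal_le_iff.2
    ⟨det_mem_adjIdeal B, fun i => derivation_det_mem_adjIdeal (pderiv i) B⟩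

/-- A determinant of linear forms is homogeneous of degree the size of the matrix: for a linear
map `L : kⁿ → k^{m×m}`, `f := det_m(L(x))` is a form of degree `m` defining the projective
hypersurface `V(f) ⊆ ℙⁿ⁻¹` of ABV Thm. 1.7 (p0003.txt:L62–L64). [cite: AlperBogartVelasco2017, Thm. 1.7 (f = det_m ∘ L)] -/
theorem isHomogeneous_det_of_linear {K : Type*} [CommRing K] {σ : Type*} {ι : Type*}
    [Fintype ι] [DecidableEq ι] (A : Matrix ι ι (MvPolynomial σ K))
    (hA : ∀ i j, (A i j).IsHomogeneous 1) : A.det.IsHomogeneous (Fintype.card ι) := by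
  rw [Matrix.det_apply]
  refine IsHomogeneous.sum _ _ _ fun π _ => ?_
  have := IsHomogeneous.prod (φ := fun i : ι => A (π i) i) univ (fun _ => 1) fun i _ => hA (π i) i
  rw [Units.smul_def, zsmul_eq_mul, ← map_intCast (C : K →+* MvPolynomial σ K)]
  simp only [sum_const, smul_eq_mul, mul_one, card_univ] at this
  simpa only [zero_add] using (isHomogeneous_C _ _).mul this

end Tools

/-! ### Prop. 2.1 (with Rem. 2.2): regularity of determinantal expressions -/

section Regularity

variable {K : Type*} [Field K] {σ : Type*} [Fintype σ]

/-- **ABV Prop. 2.1, with Rem. 2.2** (p0005.txt:L5: "Let `k` be any field. Let `f ∈ k[x₁,…,xₙ]` be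
a homogeneous polynomial satisfying `codim(Sing(f)) > 4`. If `L : kⁿ → k^{m×m}` is a determinantal
expression for `f`, then `im(L) ∩ Sing(det_m) = ∅`. In particular, `rank(L(0)) = m - 1`."; Rem. 2.2,
p0005.txt:L21: "true more generally (with the same proof) for any morphism `L : kⁿ → k^{m×m}` of
varieties such that `f(x) = det_m(L(x))`").  Height form of the first assertion, for an arbitrary
polynomial matrix `A` (Rem. 2.2) with `det A = f` and `4 < codim Sing(f)`: at every `k`-point `v`,
`rank A(v) ≥ m - 1` (`Sing(det_m) = {rank ≤ m - 2}`). Homogeneity is not needed for this part.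
Proof as printed, with Eagon's bound `height ≤ 4` for the minimal primes of the ideal of
`(m-1)`-minors (`exists_minimalPrimes_adjIdeal_height_le_four`) in place of "the standard bound for
the codimension of an inverse image … and … `codim(Sing(det_m)) = 4`". [cite: AlperBogartVelasco2017, Prop. 2.1 and Rem. 2.2] -/
theorem _root_.Literature.Computability.AlgebraicComplexity.alperBogartVelasco2017_prop_2_1
    {f : MvPolynomial σ K} (h4 : 4 < (singIdeal f).height) {m : ℕ}
    (A : Matrix (Fin m) (Fin m) (MvPolynomial σ K)) (hdet : A.det = f) (v : σ → K) :
    m ≤ (A.map (MvPolynomial.eval v)).rank + 1 := by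
  by_contra hlt
  push Not at hlt
  have hadj : (A.map (MvPolynomial.eval v)).adjugate = 0 := adjugate_eq_zero_of_rank_lt hlt
  have hm : 2 ≤ m := by omega
  have hA : (A.map (MvPolynomial.eval v)).adjugate = A.adjugate.map (MvPolynomial.eval v) := by
    show ((MvPolynomial.eval v).mapMatrix A).adjugate = _
    rw [← RingHom.map_adjugate]
    rfl
  have hle : adjIdeal A ≤ RingHom.ker (MvPolynomial.eval v) := by
    rw [adjIdeal, Ideal.span_le]
    rintro _ ⟨p, rfl⟩
    rw [SetLike.mem_coe, RingHom.mem_ker]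
    have := congrFun (congrFun hadj p.1) p.2
    rwa [hA, Matrix.map_apply, Matrix.zero_apply] at this
  have hne : adjIdeal A ≠ ⊤ := fun htop =>
    RingHom.ker_ne_top (MvPolynomial.eval v) (top_le_iff.1 (htop ▸ hle))
  obtain ⟨P, hP, hP4⟩ := exists_minimalPrimes_adjIdeal_height_le_four hm A hne
  have hsing : singIdeal f ≤ P := by
    rw [← hdet]
    exact (singIdeal_det_le_adjIdeal (by omega) A).trans hP.1.2
  exact lt_irrefl _ ((h4.trans_le ((Ideal.height_mono hsing).trans hP4)))

/-- **ABV Prop. 2.1, "in particular"** (p0005.txt:L6, L18: "`rank(L(0)) = m - 1` … since `f` is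
homogeneous, we have `det(L(0)) = f(0) = 0`"): for `f` homogeneous OF POSITIVE DEGREE (the printed
"homogeneous" is used exactly through `f(0) = 0`) with `4 < codim Sing(f)` and any polynomial
matrix `A` with `det A = f`, the constant part `A(0)` has rank exactly `m - 1`.
[cite: AlperBogartVelasco2017, Prop. 2.1] -/
theorem _root_.Literature.Computability.AlgebraicComplexity.alperBogartVelasco2017_prop_2_1_rank_zero
    {f : MvPolynomial σ K} {d : ℕ} (hf : f.IsHomogeneous d) (hd : d ≠ 0)
    (h4 : 4 < (singIdeal f).height) {m : ℕ} (A : Matrix (Fin m) (Fin m) (MvPolynomial σ K))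
    (hdet : A.det = f) : (constPart A).rank + 1 = m := by
  classical
  have hf0 : constantCoeff f = 0 := constantCoeff_eq_zero_of_isHomogeneous hf hd
  have hm : 0 < m := by
    rcases Nat.eq_zero_or_pos m with rfl | h
    · exfalso
      rw [← hdet, Matrix.det_isEmpty, map_one] at hf0
      exact one_ne_zero hf0
    · exact h
  have hge : m ≤ (constPart A).rank + 1 := by
    rw [constPart_eq_map_eval_zero]
    exact alperBogartVelasco2017_prop_2_1 h4 A hdet 0
  have hdet0 : (constPart A).det = 0 := by rw [det_constPart, hdet, hf0]
  have hlt := Matrix.rank_lt_card_of_det_eq_zero hdet0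
  rw [Fintype.card_fin] at hlt
  omega

end Regularity

/-! ### Thm. 1.2: the engine for one determinantal expression -/

section Engine

variable {K : Type*} [Field K] {σ : Type*} [Fintype σ] [DecidableEq σ]

/-- **ABV, proof of Thm. 1.2** (p0005.txt:L23–L40), for ONE affine determinantal expression of size
`n` of a homogeneous `f` of degree `d > 2` with `codim Sing(f) > 4`: `codim Sing(f) + 1 ≤ n`.
Steps as printed: `rank L(0) = n - 1` (Prop. 2.1); "by multiplying `L` by matrices on the left and
right, we may assume that `J = L(0)`" is `Λ_{i₀}` (`exists_mul_mul_eq_lamMatrix`), `L = J + Z(x)`;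
"`Z₁₁ = 0` and `Σ_j Z_{1j} Z_{j1} = 0`" from homogeneity of degree `> 2`
(`constantCoeff_pderiv_det`, `constantCoeff_pderiv_pderiv_det`); "`I` the ideal generated by the
first row and column of `Z` … `f ∈ I²` and all partial derivatives are in `I`. Thus
`V(I) ⊆ Sing(f)`" is `singIdeal f ≤ I` (row/column expansions); "`codim V(I) = dim im(G)` … `im(G)`
is entirely contained in the non-degenerate quadric … dimension at most `m - 1`" is
`finrank_add_one_le_card_of_isotropic` plus row rank = column rank (`Matrix.rank_transpose`) for the
coefficient matrix of the linear forms `Z_{1j}, Z_{j1}`; the final "`codim Sing(f) ≤ codim V(I)`" is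
Krull's height theorem for `I`, generated by a basis of those forms. [cite: AlperBogartVelasco2017, Thm. 1.2 (proof)] -/
theorem height_singIdeal_add_one_le_of_isAffineDetRepr {f : MvPolynomial σ K} {d : ℕ}
    (hf : f.IsHomogeneous d) (hd : 2 < d) (h4 : 4 < (singIdeal f).height) {n : ℕ}
    {A : Matrix (Fin n) (Fin n) (MvPolynomial σ K)} (hA : IsAffineDetRepr f A) :
    (singIdeal f).height + 1 ≤ n := by
  classical
  obtain ⟨hdeg, hdet⟩ := hA
  -- homogeneity: `f`, its first and second partials have no constant term
  have hcc0 : constantCoeff f = 0 := constantCoeff_eq_zero_of_isHomogeneous hf (by omega)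
  have hcc1 : ∀ a, constantCoeff (pderiv a f) = 0 := fun a =>
    constantCoeff_eq_zero_of_isHomogeneous hf.pderiv (by omega)
  have hcc2 : ∀ a b, constantCoeff (pderiv b (pderiv a f)) = 0 := fun a b =>
    constantCoeff_eq_zero_of_isHomogeneous hf.pderiv.pderiv (by omega)
  -- `n ≥ 1`
  have hn : 0 < n := by
    rcases Nat.eq_zero_or_pos n with rfl | h
    · exfalso
      rw [← hdet, Matrix.det_isEmpty, map_one] at hcc0
      exact one_ne_zero hcc0
    · exact h
  -- ABV Prop. 2.1: the constant part has rank exactly `n - 1`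
  have hrank : (constPart A).rank = Fintype.card (Fin n) - 1 := by
    have h := alperBogartVelasco2017_prop_2_1_rank_zero hf (by omega) h4 A hdet
    rw [Fintype.card_fin]
    omega
  -- normal form `B = V A U = J + Z(x)`, `J = Λ_{i₀}`
  obtain ⟨V, U, i₀, hV, hU, hVU⟩ :=
    exists_mul_mul_eq_lamMatrix (constPart A) hrank (by rw [Fintype.card_fin]; exact hn)
  set B : Matrix (Fin n) (Fin n) (MvPolynomial σ K) := V.map C * A * U.map C with hB
  have hB0 : constPart B = lamMatrix K i₀ := by
    rw [hB, constPart_mul, constPart_mul, constPart_map_C, constPart_map_C, hVU]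
  have hB1 : ∀ r j, (B r j).totalDegree ≤ 1 := by
    intro r j
    rw [hB, Matrix.mul_apply]
    refine totalDegree_finsetSum_le fun l _ => ?_
    rw [Matrix.mul_apply, Matrix.map_apply]
    refine (totalDegree_mul _ _).trans ?_
    rw [totalDegree_C, add_zero]
    refine totalDegree_finsetSum_le fun k _ => ?_
    rw [Matrix.map_apply]
    refine (totalDegree_mul _ _).trans ?_
    rw [totalDegree_C, zero_add]
    exact hdeg k l
  -- `det B = c · f`, `c ≠ 0`
  set c : K := V.det * U.det with hc
  have hc0 : c ≠ 0 :=
    mul_ne_zero ((Matrix.isUnit_iff_isUnit_det V).1 hV).ne_zero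
      ((Matrix.isUnit_iff_isUnit_det U).1 hU).ne_zero
  have hdetB : B.det = C c * f := by
    have hVd : (V.map (C : K →+* MvPolynomial σ K)).det = C V.det := by
      rw [← RingHom.mapMatrix_apply, ← RingHom.map_det]
    have hUd : (U.map (C : K →+* MvPolynomial σ K)).det = C U.det := by
      rw [← RingHom.mapMatrix_apply, ← RingHom.map_det]
    rw [hB, Matrix.det_mul, Matrix.det_mul, hdet, hVd, hUd, hc, map_mul]
    ring
  have hf_eq : f = C c⁻¹ * B.det := by
    rw [hdetB, ← mul_assoc, ← map_mul, inv_mul_cancel₀ hc0, map_one, one_mul]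
  -- (ABV) `Z₁₁ = 0`
  have h00 : ∀ a, coeffMat B a i₀ i₀ = 0 := by
    intro a
    rw [← constantCoeff_pderiv_det hB1 hB0 a, hdetB, pderiv_C_mul, map_mul, constantCoeff_C,
      hcc1, mul_zero]
  -- (ABV) `Σ_j Z_{1j} Z_{j1} = 0`, polarised
  have hquad : ∀ a b, ∑ s, (coeffMat B a i₀ s * coeffMat B b s i₀ +
      coeffMat B b i₀ s * coeffMat B a s i₀) = 0 := by
    intro a b
    have h := constantCoeff_pderiv_pderiv_det hB1 hB0 h00 a b
    rw [hdetB, pderiv_C_mul, pderiv_C_mul, map_mul, constantCoeff_C, hcc2, mul_zero] at h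
    exact neg_eq_zero.1 h.symm
  -- the constant part entrywise
  have hconst : ∀ r j, constantCoeff (B r j) = lamMatrix K i₀ r j := fun r j => by
    rw [← constPart_apply, hB0]
  -- the coefficient matrix of the `2n` linear forms `Z_{i₀ j}`, `Z_{j i₀}` (rows = variables)
  let M : Matrix σ (Fin n ⊕ Fin n) K :=
    Matrix.of fun w s => Sum.elim (fun j => coeffMat B w i₀ j) (fun j => coeffMat B w j i₀) s
  have hMl : ∀ w j, M w (Sum.inl j) = coeffMat B w i₀ j := fun _ _ => rfl
  have hMr : ∀ w j, M w (Sum.inr j) = coeffMat B w j i₀ := fun _ _ => rfl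
  -- linear forms from coefficient vectors
  set Λ : (σ → K) →ₗ[K] MvPolynomial σ K :=
    Fintype.linearCombination K (fun w : σ => (X w : MvPolynomial σ K)) with hΛ
  have hΛapply : ∀ cv : σ → K, Λ cv = ∑ w, C (cv w) * X w := fun cv => by
    rw [hΛ, Fintype.linearCombination_apply]
    exact Finset.sum_congr rfl fun w _ => smul_eq_C_mul _ _
  have hΛcc : ∀ cv : σ → K, constantCoeff (Λ cv) = 0 := fun cv => by
    rw [hΛapply, map_sum]
    exact Finset.sum_eq_zero fun w _ => by rw [map_mul, constantCoeff_X, mul_zero]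
  -- the first row and column of `B` are these linear forms
  have hrow_eq : ∀ j, B i₀ j = Λ (M.col (Sum.inl j)) := by
    intro j
    rw [hΛapply, eq_affine_of_totalDegree_le_one (B i₀ j) (hB1 i₀ j)]
    have h0 : coeff 0 (B i₀ j) = 0 := by
      rw [← constantCoeff_eq, hconst, lamMatrix_apply]
      by_cases hij : i₀ = j <;> simp [hij]
    rw [h0, map_zero, zero_add]
    rfl
  have hcol_eq : ∀ j, B j i₀ = Λ (M.col (Sum.inr j)) := by
    intro j
    rw [hΛapply, eq_affine_of_totalDegree_le_one (B j i₀) (hB1 j i₀)]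
    have h0 : coeff 0 (B j i₀) = 0 := by
      rw [← constantCoeff_eq, hconst, lamMatrix_apply]
      by_cases hji : j = i₀ <;> simp [hji]
    rw [h0, map_zero, zero_add]
    rfl
  -- ABV's ideal `I` of the first row and column of `Z`
  set I : Ideal (MvPolynomial σ K) := Ideal.span (Set.range fun s : Fin n ⊕ Fin n => Λ (M.col s))
    with hI
  have hrowI : ∀ j, B i₀ j ∈ I := fun j => by
    rw [hrow_eq j]
    exact Ideal.subset_span ⟨Sum.inl j, rfl⟩
  have hcolI : ∀ j, B j i₀ ∈ I := fun j => by
    rw [hcol_eq j]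
    exact Ideal.subset_span ⟨Sum.inr j, rfl⟩
  -- `f ∈ I` ("every summand of `det(J + Z(x))` is divisible by … elements of `I`")
  have hdetI : B.det ∈ I := det_mem_of_row_mem I B i₀ hrowI
  -- `∂f/∂x_a ∈ I`
  have hpdI : ∀ a, pderiv a B.det ∈ I := by
    intro a
    rw [pderiv_det_eq hB1 a]
    refine Ideal.sum_mem _ fun r _ => ?_
    by_cases hr : r = i₀
    · subst hr
      refine det_mem_of_col_mem I _ r fun i => ?_
      by_cases hi : i = r
      · subst hi
        rw [updateRow_self, h00 a, map_zero]
        exact I.zero_mem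
      · rw [updateRow_ne hi]
        exact hcolI i
    · refine det_mem_of_row_mem I _ i₀ fun j => ?_
      rw [updateRow_ne (Ne.symm hr)]
      exact hrowI j
  have hsingI : singIdeal f ≤ I := by
    refine singIdeal_le_iff.2 ⟨?_, fun a => ?_⟩
    · rw [hf_eq]
      exact I.mul_mem_left _ hdetI
    · rw [hf_eq, pderiv_C_mul]
      exact I.mul_mem_left _ (hpdI a)
  -- ABV's linear map `G = (Z_{1j}, Z_{j1})_j` : its image is isotropic for the split quadric
  let G : (σ → K) →ₗ[K] (Fin n → K) × (Fin n → K) :=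
    { toFun := fun x => (fun j => ∑ w, x w * coeffMat B w i₀ j, fun j => ∑ w, x w * coeffMat B w j i₀)
      map_add' := fun x y => by
        ext j <;> simp [add_mul, Finset.sum_add_distrib]
      map_smul' := fun r x => by
        ext j <;> simp [Finset.mul_sum, mul_assoc] }
  have hiso : ∀ z ∈ LinearMap.range G, ∀ z' ∈ LinearMap.range G,
      z.1 ⬝ᵥ z'.2 + z'.1 ⬝ᵥ z.2 = 0 := by
    rintro _ ⟨x, rfl⟩ _ ⟨x', rfl⟩
    have e1 : ∑ j, (∑ w, x w * coeffMat B w i₀ j) * (∑ w', x' w' * coeffMat B w' j i₀) =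
        ∑ w, ∑ w', x w * x' w' * ∑ j, coeffMat B w i₀ j * coeffMat B w' j i₀ := by
      calc ∑ j, (∑ w, x w * coeffMat B w i₀ j) * (∑ w', x' w' * coeffMat B w' j i₀)
          = ∑ j, ∑ w, ∑ w', (x w * coeffMat B w i₀ j) * (x' w' * coeffMat B w' j i₀) := by
            refine Finset.sum_congr rfl fun j _ => ?_
            rw [Finset.sum_mul_sum]
        _ = ∑ w, ∑ w', ∑ j, (x w * coeffMat B w i₀ j) * (x' w' * coeffMat B w' j i₀) := by
            rw [Finset.sum_comm]
            refine Finset.sum_congr rfl fun w _ => ?_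
            rw [Finset.sum_comm]
        _ = ∑ w, ∑ w', x w * x' w' * ∑ j, coeffMat B w i₀ j * coeffMat B w' j i₀ := by
            refine Finset.sum_congr rfl fun w _ => Finset.sum_congr rfl fun w' _ => ?_
            rw [Finset.mul_sum]
            refine Finset.sum_congr rfl fun j _ => ?_
            ring
    have e2 : ∑ j, (∑ w', x' w' * coeffMat B w' i₀ j) * (∑ w, x w * coeffMat B w j i₀) =
        ∑ w, ∑ w', x w * x' w' * ∑ j, coeffMat B w' i₀ j * coeffMat B w j i₀ := by
      calc ∑ j, (∑ w', x' w' * coeffMat B w' i₀ j) * (∑ w, x w * coeffMat B w j i₀)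
          = ∑ j, ∑ w', ∑ w, (x' w' * coeffMat B w' i₀ j) * (x w * coeffMat B w j i₀) := by
            refine Finset.sum_congr rfl fun j _ => ?_
            rw [Finset.sum_mul_sum]
        _ = ∑ w', ∑ w, ∑ j, (x' w' * coeffMat B w' i₀ j) * (x w * coeffMat B w j i₀) := by
            rw [Finset.sum_comm]
            refine Finset.sum_congr rfl fun w' _ => ?_
            rw [Finset.sum_comm]
        _ = ∑ w, ∑ w', x w * x' w' * ∑ j, coeffMat B w' i₀ j * coeffMat B w j i₀ := by
            rw [Finset.sum_comm]
            refine Finset.sum_congr rfl fun w _ => Finset.sum_congr rfl fun w' _ => ?_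
            rw [Finset.mul_sum]
            refine Finset.sum_congr rfl fun j _ => ?_
            ring
    show (∑ j, (∑ w, x w * coeffMat B w i₀ j) * (∑ w', x' w' * coeffMat B w' j i₀)) +
      ∑ j, (∑ w', x' w' * coeffMat B w' i₀ j) * (∑ w, x w * coeffMat B w j i₀) = 0
    rw [e1, e2, ← Finset.sum_add_distrib]
    refine Finset.sum_eq_zero fun w _ => ?_
    rw [← Finset.sum_add_distrib]
    refine Finset.sum_eq_zero fun w' _ => ?_
    rw [← mul_add, ← Finset.sum_add_distrib, hquad w w', mul_zero]
  have h0' : ∀ z ∈ LinearMap.range G, z.1 i₀ = 0 ∧ z.2 i₀ = 0 := by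
    rintro _ ⟨x, rfl⟩
    refine ⟨?_, ?_⟩
    · show ∑ w, x w * coeffMat B w i₀ i₀ = 0
      exact Finset.sum_eq_zero fun w _ => by rw [h00 w, mul_zero]
    · show ∑ w, x w * coeffMat B w i₀ i₀ = 0
      exact Finset.sum_eq_zero fun w _ => by rw [h00 w, mul_zero]
  have hrange := finrank_add_one_le_card_of_isotropic (LinearMap.range G) i₀ hiso h0'
  rw [Fintype.card_fin] at hrange
  -- `im(G)` is the row space of `M`: `dim im(G) = rank M`
  have hGe : G = (LinearEquiv.sumArrowLequivProdArrow (Fin n) (Fin n) K K).toLinearMap ∘ₗ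
      Mᵀ.mulVecLin := by
    apply LinearMap.ext
    intro x
    refine Prod.ext (funext fun j => ?_) (funext fun j => ?_)
    · show ∑ w, x w * coeffMat B w i₀ j = _
      simp only [LinearMap.coe_comp, Function.comp_apply, LinearEquiv.coe_toLinearMap,
        LinearEquiv.sumArrowLequivProdArrow_apply_fst, Matrix.mulVecLin_apply, Matrix.mulVec,
        dotProduct, Matrix.transpose_apply, hMl]
      exact Finset.sum_congr rfl fun w _ => mul_comm _ _
    · show ∑ w, x w * coeffMat B w j i₀ = _
      simp only [LinearMap.coe_comp, Function.comp_apply, LinearEquiv.coe_toLinearMap,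
        LinearEquiv.sumArrowLequivProdArrow_apply_snd, Matrix.mulVecLin_apply, Matrix.mulVec,
        dotProduct, Matrix.transpose_apply, hMr]
      exact Finset.sum_congr rfl fun w _ => mul_comm _ _
  have hrankG : finrank K (LinearMap.range G) = M.rank := by
    rw [hGe, LinearMap.range_comp, LinearEquiv.finrank_map_eq, ← Matrix.rank_transpose M]
    rfl
  -- the span `S` of the coefficient vectors of the linear forms has `dim S = rank M ≤ n - 1`
  set S : Submodule K (σ → K) := Submodule.span K (Set.range M.col) with hS
  have hSrank : finrank K S = M.rank := (Matrix.rank_eq_finrank_span_cols M).symm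
  have hSle : finrank K S + 1 ≤ n := by rw [hSrank, ← hrankG]; exact hrange
  -- `I` is generated by the `dim S` linear forms of a basis of `S`
  let b := Module.finBasis K S
  let T : Finset (MvPolynomial σ K) :=
    Finset.univ.image fun i : Fin (finrank K S) => Λ ((b i : S) : σ → K)
  have hTcard : T.card ≤ finrank K S :=
    Finset.card_image_le.trans (by rw [Finset.card_univ, Fintype.card_fin])
  have hIJ : I ≤ Ideal.span (T : Set (MvPolynomial σ K)) := by
    rw [hI, Ideal.span_le]
    rintro _ ⟨s, rfl⟩
    have hs : M.col s ∈ S := Submodule.subset_span ⟨s, rfl⟩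
    have hrepr := b.sum_repr ⟨M.col s, hs⟩
    have hcoe : M.col s = ∑ i, b.repr ⟨M.col s, hs⟩ i • ((b i : S) : σ → K) := by
      have h := congrArg Subtype.val hrepr
      rw [Submodule.coe_sum] at h
      simp only [Submodule.coe_smul] at h
      exact h.symm
    show Λ (M.col s) ∈ Ideal.span (T : Set (MvPolynomial σ K))
    rw [hcoe, map_sum]
    refine Ideal.sum_mem _ fun i _ => ?_
    rw [map_smul]
    exact Submodule.smul_of_tower_mem _ _
      (Ideal.subset_span (Finset.mem_coe.2 (Finset.mem_image_of_mem _ (Finset.mem_univ i))))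
  have hTtop : Ideal.span (T : Set (MvPolynomial σ K)) ≠ ⊤ :=
    span_ne_top_of_constantCoeff fun g hg => by
      obtain ⟨i, -, rfl⟩ := Finset.mem_image.1 (Finset.mem_coe.1 hg)
      exact hΛcc _
  -- Krull: `codim Sing(f) ≤ height (T) ≤ |T| ≤ dim S ≤ n - 1`
  obtain ⟨k, rfl⟩ : ∃ k, n = k + 1 := ⟨n - 1, by omega⟩
  have hheight : (singIdeal f).height ≤ (k : ℕ∞) :=
    (height_le_card_of_le_span (hsingI.trans hIJ) hTtop).trans
      (by exact_mod_cast hTcard.trans (by omega))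
  calc (singIdeal f).height + 1 ≤ (k : ℕ∞) + 1 := add_le_add hheight le_rfl
    _ = ((k + 1 : ℕ) : ℕ∞) := (Nat.cast_succ k).symm

end Engine

end AlperBogartVelasco

/-! ### Thm. 1.2 and its corollaries -/

section Main

open AlperBogartVelasco VonZurGathen

/-- **ABV Thm. 1.2** (p0003.txt:L10–L13: "Let `k` be a field. Let `f ∈ k[x₁, …, xₙ]` be a
homogeneous polynomial of degree `d > 2`. If `codim(Sing(f)) > 4`, then
`dc(f) ≥ codim(Sing(f)) + 1`."), with `codim Sing(f) = (singIdeal f).height` (module docstring)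
and `dc = determinantalComplexity` (affine determinantal expressions, Def. 1.1 = the tree's
`IsAffineDetRepr`; the infimum is attained, `hasDetRepr_determinantalComplexity_holds`). The
variables range over an arbitrary finite index type `σ` (`n = |σ|`). PROVED via
`AlperBogartVelasco.height_singIdeal_add_one_le_of_isAffineDetRepr`. [cite: AlperBogartVelasco2017, Thm. 1.2] -/
theorem alperBogartVelasco2017_thm_1_2 {K : Type*} [Field K] {σ : Type*} [Fintype σ]
    [DecidableEq σ] {f : MvPolynomial σ K} {d : ℕ} (hf : f.IsHomogeneous d) (hd : 2 < d)
    (h4 : 4 < (singIdeal f).height) :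
    (singIdeal f).height + 1 ≤ determinantalComplexity f := by
  obtain ⟨A, hA⟩ := hasDetRepr_determinantalComplexity_holds f
  exact height_singIdeal_add_one_le_of_isAffineDetRepr hf hd h4 hA

/-- **ABV Thm. 1.2, `ℕ`-valued form** (same statement, p0003.txt:L10–L13, for users working in
`ℕ` such as the `dc` lower-bound routes): if `c ≤ codim Sing(f)` for a natural number `c > 4`, then
`c + 1 ≤ dc(f)`. PROVED from `alperBogartVelasco2017_thm_1_2`. [cite: AlperBogartVelasco2017, Thm. 1.2] -/
theorem alperBogartVelasco2017_thm_1_2_nat {K : Type*} [Field K] {σ : Type*} [Fintype σ]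
    [DecidableEq σ] {f : MvPolynomial σ K} {d : ℕ} (hf : f.IsHomogeneous d) (hd : 2 < d)
    {c : ℕ} (hc : 4 < c) (hcf : (c : ℕ∞) ≤ (singIdeal f).height) :
    c + 1 ≤ determinantalComplexity f := by
  have h4 : (4 : ℕ∞) < (singIdeal f).height := lt_of_lt_of_le (by exact_mod_cast hc) hcf
  have h := (add_le_add hcf le_rfl).trans (alperBogartVelasco2017_thm_1_2 hf hd h4)
  exact_mod_cast h

/-- **von zur Gathen's input to Cor. 1.3** (ABV p0003.txt:L31: "Since it is known that
`codim(Sing(per_n)) > 4` for `n > 2` (c.f. [von-zur-gathen]) if `char(k) ≠ 2`"), in the height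
currency: `5 ≤ (singIdeal per_n).height` for `n ≥ 3` over a field with `2 ≠ 0` — every prime over
`singPermIdeal` has height `≥ 5` (`AlperBogartVelasco.five_le_height_of_singPermIdeal_le`, the
tree's proof of vzG Lemma 2.3). [cite: Vonzurgathen1987, Lemma 2.3] -/
theorem five_le_height_singIdeal_perPoly {K : Type*} [Field K] (h2 : (2 : K) ≠ 0) {n : ℕ}
    (hn : 3 ≤ n) : (5 : ℕ∞) ≤ (singIdeal (perPoly (Fin n) K)).height := by
  rw [singIdeal_perPoly, Ideal.height_eq_inf_minimalPrimes]
  refine le_iInf₂ fun P hP => ?_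
  haveI := hP.1.1
  exact five_le_height_of_singPermIdeal_le h2 hn P hP.1.2

/-- **ABV Cor. 1.3** (p0003.txt:L33–L36: "Let `k` be a field with `char(k) ≠ 2`. If `n > 2`, then
`dc(per_n) ≥ codim(Sing(per_n)) + 1`."), `char(k) ≠ 2` as `ringChar k ≠ 2`, `per_n` the tree's
`perPoly (Fin n) k`, `codim Sing = height ∘ singIdeal`. PROVED: Thm. 1.2 (`per_n` is homogeneous of
degree `n > 2`) and `codim Sing(per_n) ≥ 5` (`five_le_height_singIdeal_perPoly`).
[cite: AlperBogartVelasco2017, Cor. 1.3] -/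
theorem alperBogartVelasco2017_cor_1_3 (K : Type*) [Field K] (hK : ringChar K ≠ 2) {n : ℕ}
    (hn : 2 < n) :
    (singIdeal (perPoly (Fin n) K)).height + 1 ≤ determinantalComplexity (perPoly (Fin n) K) := by
  classical
  have h2 : (2 : K) ≠ 0 := Ring.two_ne_zero hK
  have hhom : (perPoly (Fin n) K).IsHomogeneous n := by
    simpa [Fintype.card_fin] using perPoly_isHomogeneous (n := Fin n) (k := K)
  exact alperBogartVelasco2017_thm_1_2 hhom hn
    (lt_of_lt_of_le (by decide) (five_le_height_singIdeal_perPoly h2 hn))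

/-- **ABV Rem. 1.5** (p0003.txt:L45–L47: "Since any matrix where the first two columns are zero is
a singular point of `V(per_n)`, it follows that `codim(Sing(per_n)) ≤ 2n`. Therefore, even if the
codimension of `Sing(per_n)` achieves the maximum value `2n`, Corollary 1.3 would only give the
linear bound `dc(per_n) ≥ 2n + 1`.") — the CEILING of the singular-locus method. Height form,
`n ≥ 2` (two columns), any field: `(singIdeal per_n).height ≤ 2n`, because `per_n` and all its
partials `per(r|c)` lie in the ideal of the `2n` variables of the first two columns (every term of
`per(r|c)` uses all columns but `c`), whose minimal primes have height `≤ 2n` (Krull).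
[cite: AlperBogartVelasco2017, Rem. 1.5] -/
theorem alperBogartVelasco2017_rem_1_5 (K : Type*) [Field K] {n : ℕ} (hn : 2 ≤ n) :
    (singIdeal (perPoly (Fin n) K)).height ≤ 2 * n := by
  classical
  let c0 : Fin n := ⟨0, by omega⟩
  let c1 : Fin n := ⟨1, by omega⟩
  have hc01 : c0 ≠ c1 := fun h => by
    have := congrArg Fin.val h
    simp [c0, c1] at this
  -- the `2n` variables of the first two columns
  let T : Finset (MvPolynomial (Fin n × Fin n) K) :=
    Finset.univ.image (fun i : Fin n => (X (i, c0) : MvPolynomial (Fin n × Fin n) K)) ∪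
      Finset.univ.image (fun i : Fin n => (X (i, c1) : MvPolynomial (Fin n × Fin n) K))
  have hTcard : T.card ≤ 2 * n := by
    refine (Finset.card_union_le _ _).trans ?_
    have h1 := Finset.card_image_le (s := Finset.univ)
      (f := fun i : Fin n => (X (i, c0) : MvPolynomial (Fin n × Fin n) K))
    have h2 := Finset.card_image_le (s := Finset.univ)
      (f := fun i : Fin n => (X (i, c1) : MvPolynomial (Fin n × Fin n) K))
    rw [Finset.card_univ, Fintype.card_fin] at h1 h2
    omega
  have hXmem : ∀ i c, c = c0 ∨ c = c1 →
      (X (i, c) : MvPolynomial (Fin n × Fin n) K) ∈ Ideal.span (T : Set _) := by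
    rintro i c (rfl | rfl)
    · exact Ideal.subset_span (Finset.mem_coe.2 (Finset.mem_union_left _
        (Finset.mem_image_of_mem _ (Finset.mem_univ i))))
    · exact Ideal.subset_span (Finset.mem_coe.2 (Finset.mem_union_right _
        (Finset.mem_image_of_mem _ (Finset.mem_univ i))))
  have hle : singIdeal (perPoly (Fin n) K) ≤ Ideal.span (T : Set _) := by
    refine singIdeal_le_iff.2 ⟨?_, ?_⟩
    · -- every term of `per_n` has the factor `x_{π c0, c0}`
      rw [perPoly, Matrix.permanent]
      refine Ideal.sum_mem _ fun π _ => ?_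
      rw [← Finset.mul_prod_erase _ _ (Finset.mem_univ c0)]
      refine Ideal.mul_mem_right _ _ ?_
      exact hXmem _ _ (Or.inl rfl)
    · -- every term of `per(r|c)` has a factor from a column `≠ c` among the first two
      rintro ⟨r, c⟩
      rw [pderiv_perPoly, Matrix.subperm]
      refine Ideal.sum_mem _ fun g _ => ?_
      have hsel : ∃ c' : Fin n, c' ≠ c ∧ (c' = c0 ∨ c' = c1) := by
        by_cases h : c = c0
        · exact ⟨c1, fun h' => hc01 (h'.trans h).symm, Or.inr rfl⟩
        · exact ⟨c0, fun h' => h h'.symm, Or.inl rfl⟩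
      obtain ⟨c', hc', hc'01⟩ := hsel
      rw [← Finset.mul_prod_erase _ _ (Finset.mem_univ (⟨c', hc'⟩ : {i // i ≠ c}))]
      refine Ideal.mul_mem_right _ _ ?_
      exact hXmem _ _ hc'01
  refine (height_le_card_of_le_span hle (span_ne_top_of_constantCoeff fun g hg => ?_)).trans
    (by exact_mod_cast hTcard)
  rcases Finset.mem_union.1 (Finset.mem_coe.1 hg) with h | h
  · obtain ⟨i, -, rfl⟩ := Finset.mem_image.1 h
    exact constantCoeff_X K _
  · obtain ⟨i, -, rfl⟩ := Finset.mem_image.1 h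
    exact constantCoeff_X K _

/-- **ABV Cor. 1.6** (p0003.txt:L53–L55: "Let `k` be a field. Assume that `n > 4` and `d ≤ n`. If
`f(x₁, …, xₙ)` is a non-degenerate homogeneous form (i.e. the hypersurface `V(f) ⊆ ℙⁿ⁻¹` is
nonsingular) of degree `d > 2`, then `dc(f) ≥ n + 1`."). "Non-degenerate" = the affine cone
`V(f) ⊆ kⁿ` is singular only at the origin = `codim Sing(f) = n`, typed as
`n ≤ (singIdeal f).height` (for `f` homogeneous of degree `≥ 2` the height is `≤ n`,
`AlperBogartVelasco.height_singIdeal_le_card`, so this is `= n`). The printed hypothesis `d ≤ n`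
is carried but not used by the proof (it delimits the classical question `dc(f) = d`, p0003.txt:L51).
PROVED from Thm. 1.2. [cite: AlperBogartVelasco2017, Cor. 1.6] -/
theorem alperBogartVelasco2017_cor_1_6 {K : Type*} [Field K] {n d : ℕ} (hn : 4 < n)
    (_hdn : d ≤ n) {f : MvPolynomial (Fin n) K} (hf : f.IsHomogeneous d) (hd : 2 < d)
    (hnondeg : (n : ℕ∞) ≤ (singIdeal f).height) :
    (n : ℕ∞) + 1 ≤ determinantalComplexity f := by
  have h4 : (4 : ℕ∞) < (singIdeal f).height := lt_of_lt_of_le (by exact_mod_cast hn) hnondeg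
  exact (add_le_add hnondeg le_rfl).trans (alperBogartVelasco2017_thm_1_2 hf hd h4)

/-- **ABV Cor. 1.6, "in particular"** (p0003.txt:L57: "Corollary 1.6 implies that for `n > 4`
and `d ≤ n`, there does not exist a nonsingular hypersurface of degree `d` in `ℙⁿ⁻¹` having a
determinantal expression of size `d`"; abstract, p0002: "for `n > 3`, there is no nonsingular
hypersurface in `ℙⁿ` of degree `d` that has an expression as a determinant of a `d × d` matrix of
linear forms") — here the printed hypothesis `d ≤ n` IS used: `dc(f) ≥ n + 1 > d`. Nonsingularity
typed as in `alperBogartVelasco2017_cor_1_6` (`n ≤ codim Sing(f)`); "determinantal expression of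
size `d`" = the tree's `HasDetRepr f d` (affine entries, which includes the linear ones). PROVED.
[cite: AlperBogartVelasco2017, Cor. 1.6 (in particular)] -/
theorem alperBogartVelasco2017_cor_1_6_not_hasDetRepr {K : Type*} [Field K] {n d : ℕ}
    (hn : 4 < n) (hdn : d ≤ n) {f : MvPolynomial (Fin n) K} (hf : f.IsHomogeneous d) (hd : 2 < d)
    (hnondeg : (n : ℕ∞) ≤ (singIdeal f).height) : ¬ HasDetRepr f d := by
  intro h
  have hdc : determinantalComplexity f ≤ d := determinantalComplexity_le_of_hasDetRepr h
  have h1 := alperBogartVelasco2017_cor_1_6 hn hdn hf hd hnondeg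
  have h2 : ((n : ℕ) : ℕ∞) + 1 ≤ (d : ℕ∞) := h1.trans (by exact_mod_cast hdc)
  have h3 : n + 1 ≤ d := by exact_mod_cast h2
  omega

/-! ### Thm. 1.7 (Bertini) -/

/-- **ABV Thm. 1.7, the inequality** (p0003.txt:L61–L62: "Let `k` be an algebraically closed field
with `char(k) = 0`. Let `L : kⁿ → k^{m×m}` be a linear map with `m ≥ 2`. Let `f(x) := det_m(L(x))`.
Then `codim(Sing(f)) ≤ min(4, n)` …"). `L` linear = a matrix `A` of linear forms (entries
homogeneous of degree `1`), `n = |σ|`, `codim Sing = height ∘ singIdeal`. PROVED for every field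
(the hypotheses algebraically closed / characteristic `0` serve the equality clause, which is the
named fact `alperBogartVelasco2017_thm_1_7_general`): `≤ 4` because `singIdeal (det A)` lies in the
proper ideal of the `(m-1)`-minors of `A`, which has a minimal prime of height `≤ 4` (Eagon,
`exists_minimalPrimes_adjIdeal_height_le_four`; ABV: "`codim(Sing(det_m)) = 4` … the codimension of
the singular locus can only decrease after intersecting", p0005.txt:L46–L47); `≤ n` because
`det A` is homogeneous of degree `m ≥ 2` (`height_singIdeal_le_card`). [cite: AlperBogartVelasco2017, Thm. 1.7] -/
theorem alperBogartVelasco2017_thm_1_7_le {K : Type*} [Field K] {σ : Type*} [Fintype σ] {m : ℕ}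
    (hm : 2 ≤ m) (A : Matrix (Fin m) (Fin m) (MvPolynomial σ K))
    (hA : ∀ i j, (A i j).IsHomogeneous 1) :
    (singIdeal A.det).height ≤ min (4 : ℕ∞) (Fintype.card σ) := by
  classical
  have hconst : constPart A = 0 := by
    ext i j
    rw [constPart_apply, Matrix.zero_apply]
    exact constantCoeff_eq_zero_of_isHomogeneous (hA i j) one_ne_zero
  have hhom : A.det.IsHomogeneous m := by
    simpa [Fintype.card_fin] using isHomogeneous_det_of_linear A hA
  refine le_min ?_ ?_
  · -- Eagon for the ideal of `(m-1)`-minors, which is proper: the minors have no constant term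
    haveI : Nontrivial (Fin m) := Fin.nontrivial_iff_two_le.2 hm
    have hne : adjIdeal A ≠ ⊤ := by
      refine span_ne_top_of_constantCoeff ?_
      rintro _ ⟨p, rfl⟩
      have h : constantCoeff (A.adjugate p.1 p.2) =
          ((constantCoeff : MvPolynomial σ K →+* K).mapMatrix A.adjugate) p.1 p.2 := rfl
      rw [h, RingHom.map_adjugate]
      have h' : (constantCoeff : MvPolynomial σ K →+* K).mapMatrix A = constPart A := rfl
      rw [h', hconst, Matrix.adjugate_zero, Matrix.zero_apply]
    obtain ⟨P, hP, hP4⟩ := exists_minimalPrimes_adjIdeal_height_le_four hm A hne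
    exact (Ideal.height_mono ((singIdeal_det_le_adjIdeal (by omega) A).trans hP.1.2)).trans hP4
  · refine height_singIdeal_le_card (constantCoeff_eq_zero_of_isHomogeneous hhom (by omega))
      fun i => constantCoeff_eq_zero_of_isHomogeneous hhom.pderiv (by omega)

/-- **ABV Thm. 1.7, second bullet** (p0003.txt:L68: "if `n > 4` then `V(f)` is singular for every
linear map `L`"): with `n = |σ| > 4`, `codim Sing(det A) ≤ 4 < n`, i.e. the singular locus of the
cone is larger than the origin (height form: `(singIdeal (det A)).height < n`). PROVED from
`alperBogartVelasco2017_thm_1_7_le`. [cite: AlperBogartVelasco2017, Thm. 1.7] -/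
theorem alperBogartVelasco2017_thm_1_7_singular {K : Type*} [Field K] {σ : Type*} [Fintype σ]
    {m : ℕ} (hm : 2 ≤ m) (A : Matrix (Fin m) (Fin m) (MvPolynomial σ K))
    (hA : ∀ i j, (A i j).IsHomogeneous 1) (hn : 4 < Fintype.card σ) :
    (singIdeal A.det).height < Fintype.card σ :=
  lt_of_le_of_lt ((alperBogartVelasco2017_thm_1_7_le hm A hA).trans (min_le_left _ _))
    (by exact_mod_cast hn)

/-- NAMED FACT — **ABV Thm. 1.7, the equality clause** (p0003.txt:L61–L66: over an algebraically
closed field of characteristic `0`, for a linear map `L : kⁿ → k^{m×m}`, `m ≥ 2`,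
`codim(Sing(det_m ∘ L)) = min(4, n)` "if `L` is a general linear map"; first bullet: "if `n ≤ 4`
then `V(f)` is nonsingular for a general linear map `L`"). "General" is typed in the standard way:
there is a nonzero polynomial `Φ` in the `m²n` coefficients `c_{ijw}` of `L = (Σ_w c_{ijw} x_w)_{ij}`
such that the equality holds whenever `Φ(c) ≠ 0`. The printed proof is `m² - n` applications of
Bertini's theorem (p0005.txt:L43–L57; Harris, GTM 133, 17.16), which is not in Mathlib; stated as a
fact, users take `(h : alperBogartVelasco2017_thm_1_7_general)`. The inequality `≤` is the PROVED
`alperBogartVelasco2017_thm_1_7_le`. [cite: AlperBogartVelasco2017, Thm. 1.7] -/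
def alperBogartVelasco2017_thm_1_7_general : Prop :=
  ∀ (K : Type*) [Field K] [IsAlgClosed K] [CharZero K] (n m : ℕ), 2 ≤ m →
    ∃ Φ : MvPolynomial (Fin m × Fin m × Fin n) K, Φ ≠ 0 ∧
      ∀ c : Fin m × Fin m × Fin n → K, MvPolynomial.eval c Φ ≠ 0 →
        (singIdeal (Matrix.of fun i j : Fin m =>
            ∑ w : Fin n, C (c (i, j, w)) * (X w : MvPolynomial (Fin n) K)).det).height
          = min 4 n

/-! ### Thm. 1.8: the cubic surface with a single line -/

/-- ABV's cubic surface `f = x y² + y t² + z³ ∈ K[x, y, z, t]` (p0004.txt:L3–L7: "the unique cubic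
surface (up to projective equivalence) in `ℙ³` containing a single line"), with the variables
`x, y, z, t` numbered `0, 1, 2, 3`. [cite: AlperBogartVelasco2017, Thm. 1.8] -/
def abvCubic (K : Type*) [CommRing K] : MvPolynomial (Fin 4) K :=
  X 0 * X 1 ^ 2 + X 1 * X 3 ^ 2 + X 2 ^ 3

/-- Unfolding lemma for `abvCubic`. [cite: AlperBogartVelasco2017, Thm. 1.8] -/
theorem abvCubic_def (K : Type*) [CommRing K] :
    abvCubic K = X 0 * X 1 ^ 2 + X 1 * X 3 ^ 2 + X 2 ^ 3 := rfl

/-- NAMED FACT — **ABV Thm. 1.8** (p0004.txt:L7: "Let `k` be a field with `char(k) = 0`. Then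
`dc(xy² + yt² + z³) = 5`."; it "answer[s] a question of Ressayre", p0002). The upper bound is the
explicit `5 × 5` matrix of p0006.txt:L49–L55, PROVED below
(`determinantalComplexity_abvCubic_le_five`, over any commutative ring); the lower bound `dc > 4` is
the case analysis of p0006.txt:L1–L47 on the rank `r ∈ {1, 2, 3}` of `L(0)` on top of
Brundu–Logar's `dc > 3` [BrunduLogar1998], not vendored here. Users take
`(h : alperBogartVelasco2017_thm_1_8)`. [cite: AlperBogartVelasco2017, Thm. 1.8] -/
def alperBogartVelasco2017_thm_1_8 : Prop :=
  ∀ (K : Type*) [Field K] [CharZero K], determinantalComplexity (abvCubic K) = 5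

/-- **ABV Thm. 1.8, upper bound** (p0006.txt:L47–L57: "one can check that `f = det` of
`[[-y, z, 0, 0, 0], [0, 0, z, t, x], [z, 0, 1, 0, 0], [0, t, 0, 1, 0], [0, y, 0, 0, 1]]`, which
implies that `dc(f) = 5`" — i.e. `≤ 5`). PROVED over any commutative ring: the printed matrix is the
block matrix `[[P, Q], [R, 1₃]]` with `P = [[-y, z], [0, 0]]`, `Q = [[0, 0, 0], [z, t, x]]`,
`R = [[z, 0], [0, t], [0, y]]` (re-indexed along `Fin 2 ⊕ Fin 3 ≃ Fin 5`), whose determinant is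
`det (P - Q R) = det [[-y, z], [-z², -(t² + x y)]] = x y² + y t² + z³` (Schur complement,
`Matrix.det_fromBlocks_one₂₂`). [cite: AlperBogartVelasco2017, Thm. 1.8 (proof)] -/
theorem determinantalComplexity_abvCubic_le_five (K : Type*) [CommRing K] :
    determinantalComplexity (abvCubic K) ≤ 5 := by
  let P : Matrix (Fin 2) (Fin 2) (MvPolynomial (Fin 4) K) := !![-X 1, X 2; 0, 0]
  let Q : Matrix (Fin 2) (Fin 3) (MvPolynomial (Fin 4) K) := !![0, 0, 0; X 2, X 3, X 0]
  let R : Matrix (Fin 3) (Fin 2) (MvPolynomial (Fin 4) K) := !![X 2, 0; 0, X 3; 0, X 1]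
  let N : Matrix (Fin 5) (Fin 5) (MvPolynomial (Fin 4) K) :=
    Matrix.reindex finSumFinEquiv finSumFinEquiv (Matrix.fromBlocks P Q R 1)
  refine determinantalComplexity_le_of_hasDetRepr ⟨N, fun i j => ?_, ?_⟩
  · -- entries are `0`, `1`, `± a variable`
    show ((Matrix.reindex finSumFinEquiv finSumFinEquiv (Matrix.fromBlocks P Q R 1)) i j).totalDegree
      ≤ 1
    rw [Matrix.reindex_apply, Matrix.submatrix_apply]
    generalize (finSumFinEquiv (m := 2) (n := 3)).symm i = p
    generalize (finSumFinEquiv (m := 2) (n := 3)).symm j = q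
    have hX : ∀ k : Fin 4, ((X k : MvPolynomial (Fin 4) K)).totalDegree ≤ 1 := fun k => by
      simpa [X, Finsupp.sum_single_index] using
        totalDegree_monomial_le (R := K) (Finsupp.single k 1) 1
    rcases p with p | p <;> rcases q with q | q
    · rw [Matrix.fromBlocks_apply₁₁]
      fin_cases p <;> fin_cases q
      · simpa [P, totalDegree_neg] using hX 1
      · simpa [P] using hX 2
      · simp [P]
      · simp [P]
    · rw [Matrix.fromBlocks_apply₁₂]
      fin_cases p <;> fin_cases q
      · simp [Q]
      · simp [Q]
      · simp [Q]
      · simpa [Q] using hX 2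
      · simpa [Q] using hX 3
      · simpa [Q] using hX 0
    · rw [Matrix.fromBlocks_apply₂₁]
      fin_cases p <;> fin_cases q
      · simpa [R] using hX 2
      · simp [R]
      · simp [R]
      · simpa [R] using hX 3
      · simp [R]
      · simpa [R] using hX 1
    · rw [Matrix.fromBlocks_apply₂₂, Matrix.one_apply]
      split_ifs <;> simp
  · show (Matrix.reindex finSumFinEquiv finSumFinEquiv (Matrix.fromBlocks P Q R 1)).det = abvCubic K
    rw [Matrix.det_reindex_self, Matrix.det_fromBlocks_one₂₂, Matrix.det_fin_two, abvCubic]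
    simp [P, Q, R]
    ring

/-- `x y² + y t² + z³` is a cubic form. [cite: AlperBogartVelasco2017, Thm. 1.8] -/
theorem abvCubic_isHomogeneous (K : Type*) [CommRing K] : (abvCubic K).IsHomogeneous 3 := by
  rw [abvCubic]
  have h0 : (X 0 * X 1 ^ 2 : MvPolynomial (Fin 4) K).IsHomogeneous 3 :=
    (isHomogeneous_X K 0).mul ((isHomogeneous_X K 1).pow 2)
  have h1 : (X 1 * X 3 ^ 2 : MvPolynomial (Fin 4) K).IsHomogeneous 3 :=
    (isHomogeneous_X K 1).mul ((isHomogeneous_X K 3).pow 2)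
  have h2 : (X 2 ^ 3 : MvPolynomial (Fin 4) K).IsHomogeneous 3 := (isHomogeneous_X K 2).pow 3
  exact (h0.add h1).add h2

end Main

end Literature.Computability.AlgebraicComplexity
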